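import Summits.BirchSwinnertonDyer.BirchSwinnertonDyer.Theorems.ManinLocalTwoThreeNegOneTwistTypeTwoFour
import Literature.NumberTheory.EllipticCurves.NeronComponentIndexTypeI0starProofs
import Literature.NumberTheory.EllipticCurves.KodairaDiscriminantValuesTwoProofs
import Literature.NumberTheory.DiophantineGeometry.TateAlgorithmIstarEvalProofs
import HarnessLib

/-!
# S-an-63 «16 ∥ N descends», row `I₀*/8` — part 1: Tate's algorithm on the `χ₋₄`-twist of the `I₀*` normal form at `2`
# (route `ManinLocalTwoThree`, crux C2 `ManinOddAtFour` stmt-BirchSwinnertonDyer-22967; cell bsd-f2-manin, an's candidate S-an-63; p3 gen 12)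

The Step-6 normal form of a type-`I₀*` curve at `2` is `N = [2α, 2p, 4γ, 4q, 8r]` with `pq + r ∈ ℤ₂ˣ` (separable cubic); `ord₂ Δ = 8`
adds `α²q + γ² ∈ ℤ₂ˣ` (`addVal_Δ_toNat_of_step6`).  Its `χ₋₄`-twist read over `ℚ₂` is `T = [0, −(α²+2p), 0, 4(q+αγ), −4(γ²+2r)]`
(§2), and `T″ = (1, 0, α, 2γ) • T = [2α, −2(α²+p), 4γ, 4q, −8(γ²+r)]` is again Step-6 normalised with cubic
`T³ + P̄′T² + q̄T + R̄′`, `P′ = −(α²+p)`, `R′ = −(γ²+r)`, now INSEPARABLE (`P̄′q̄ + R̄′ = (α²q+γ²)‾ + (pq+r)‾ = 0` in `𝔽₂`).  §3 runs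
the algorithm on `T″` (and on `T‴ = (1, 2, 0, 0) • T″` when the multiple root is `1`) in the four residue cases:
* A0 (`2 ∣ α²+p`, `2 ∣ q`, `2 ∣ γ²+r`, `γ ∈ ℤ₂ˣ`): Step 8 on `T″`, quadratic `Y² + γ̄Y − …` separable: **IV***;
* A1 (translated: `4 ∣ a₂‴`, `8 ∣ a₄‴`, `16 ∣ a₆‴`, `a₃‴ = 4(γ+α)`, `γ + α ∈ ℤ₂ˣ`): Step 8 on `T‴`: **IV***;
* B0 (`2 ∤ α²+p`, `2 ∣ q`, `2 ∣ γ²+r`, `γ ∈ ℤ₂ˣ`): cubic `T²(T+1)`, round `0` of Step 7 on `T″`, first quadratic separable: **I₁*** (`kodairaSymbolOfMinimal_eq_Istar_of_models`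
  + `istarIndexAux_succ_of_testA`, fuel `ord Δ(T″) = 8`);
* B1 (`2 ∣ α²+p`, `2 ∤ q`, `2 ∣ γ²+r`, `γ + α ∈ ℤ₂ˣ`): cubic `T(T+1)²`, round-`0` model `T‴`: **I₁***.
§1: `ℤ₂` residue bookkeeping (`𝔽₂ = {0, 1}`, `redCoeff (2ʲx) j = x̄`).  Part 2 (`…NegOneTwistIstarZeroEight`) assembles `f₂(W ⊗ (−1)) ∈ {2, 3}`.
HONEST FRAMING: local Tate-algorithm bookkeeping in print; nothing about BSD or Manin's conjecture is proved; C2 OPEN.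
[cite: SilvermanATAEC1994, IV.9.4 Steps 6–8 (PDF pp. 345–346)] [cite: BarriosEtAl2025, Thm. 5.1 (arXiv:2501.03209 p. 16), row I₀*]
-/

set_option autoImplicit false
-- lint-debt: the directory name repeats the summit name (sibling precedent `ManinLocalTwoThreeNegOneTwistConductorAtTwo.lean`)
set_option linter.dupNamespace false

noncomputable section

open scoped Classical
open Polynomial IsLocalRing WeierstrassCurve
open IsDiscreteValuationRing hiding maximalIdeal
open Literature.NumberTheory.DiophantineGeometry Literature.NumberTheory.DiophantineGeometry.TateAlgorithm
  Literature.NumberTheory.DiophantineGeometry.TateAlgorithm.CharTwo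

namespace Summit.BirchSwinnertonDyer.BirchSwinnertonDyer.Theorems.ManinLocalTwoThree

/-! ## §1 `ℤ₂` bookkeeping: residues are `0` or `1`, `redCoeff (2ʲ x) j = x̄` -/

/-- Every element of the residue field `𝔽₂` of `ℤ₂` is `0` or `1`. [folklore] -/
theorem residueField_two_eq_zero_or_one (x : ResidueField ℤ_[2]) : x = 0 ∨ x = 1 := by
  set e := PadicInt.residueField (p := 2) with he
  have key : ∀ y : ZMod 2, y = 0 ∨ y = 1 := by decide
  rcases key (e x) with h | h
  · left; apply e.injective; rw [h, map_zero]
  · right; apply e.injective; rw [h, map_one]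

/-- In `ℤ₂`, the residue of a unit is `1`. [folklore] -/
theorem residue_eq_one_of_isUnit_padicInt {x : ℤ_[2]} (hx : IsUnit x) : residue ℤ_[2] x = 1 := by
  rcases residueField_two_eq_zero_or_one (residue ℤ_[2] x) with h | h
  · exact absurd h ((residue_ne_zero_iff_isUnit x).mpr hx)
  · exact h

/-- In `ℤ₂`, `redCoeff (2ʲ x) j = x̄` (`2 = ϖμ` with `μ̄ = 1`). [folklore] -/
theorem redCoeff_two_pow_mul (x : ℤ_[2]) (j : ℕ) : redCoeff ((2 : ℤ_[2]) ^ j * x) j = residue ℤ_[2] x := by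
  have hirr : Irreducible (2 : ℤ_[2]) := by exact_mod_cast PadicInt.irreducible_p (p := 2)
  obtain ⟨μu, hμ⟩ := associated_of_irreducible ℤ_[2] irreducible_uniformizer hirr
  rw [← hμ, mul_pow, mul_assoc, redCoeff_uniformizer_pow_mul, map_mul, map_pow,
    residue_eq_one_of_isUnit_padicInt (Units.isUnit μu), one_pow, one_mul]

/-- In `ℤ₂`, `redCoeff (2 x) 1 = x̄`. [folklore] -/
theorem redCoeff_two_mul (x : ℤ_[2]) : redCoeff ((2 : ℤ_[2]) * x) 1 = residue ℤ_[2] x := by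
  simpa using redCoeff_two_pow_mul x 1

/-- `2^{k+1} ∣ 2^k x` in `ℤ₂` iff `2 ∣ x`. [folklore] -/
theorem two_pow_succ_dvd_mul_iff {k : ℕ} {x : ℤ_[2]} : (2 : ℤ_[2]) ^ (k + 1) ∣ 2 ^ k * x ↔ (2 : ℤ_[2]) ∣ x := by
  rw [pow_succ]; exact mul_dvd_mul_iff_left (pow_ne_zero _ (by norm_num))

/-- `2 ∣ x` in `ℤ₂` iff `x̄ = 0`. [folklore] -/
theorem two_dvd_iff_residue_eq_zero (x : ℤ_[2]) : (2 : ℤ_[2]) ∣ x ↔ residue ℤ_[2] x = 0 := by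
  have hirr : Irreducible (2 : ℤ_[2]) := by exact_mod_cast PadicInt.irreducible_p (p := 2)
  exact dvd_iff_residue_eq_zero hirr x

/-! ## §2 The `χ₋₄`-twist of the `I₀*` normal form -/

/-- Twist of the Step-6 form `[2α, 2p, 4γ, 4q, 8r]`: `[0, −(α² + 2p), 0, 4(q + αγ), −4(γ² + 2r)]`, read over `ℚ₂`.
[cite: SilvermanAEC2009, X.2 Prop. 2.4 (shape of the quadratic twist)] -/
theorem quadraticTwist_negOne_map_of_IstarZeroForm (N : WeierstrassCurve ℤ_[2]) {α p γ q r : ℤ_[2]}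
    (h₁ : N.a₁ = 2 * α) (h₂ : N.a₂ = 2 * p) (h₃ : N.a₃ = 2 ^ 2 * γ) (h₄ : N.a₄ = 2 ^ 2 * q) (h₆ : N.a₆ = 2 ^ 3 * r) :
    (N.map (algebraMap ℤ_[2] ℚ_[2])).quadraticTwist (-1) =
      (⟨0, -(α ^ 2 + 2 * p), 0, 4 * (q + α * γ), -(4 * (γ ^ 2 + 2 * r))⟩ : WeierstrassCurve ℤ_[2]).map
        (algebraMap ℤ_[2] ℚ_[2]) := by
  obtain ⟨a₁, a₂, a₃, a₄, a₆⟩ := N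
  simp only at h₁ h₂ h₃ h₄ h₆
  subst h₁ h₂ h₃ h₄ h₆
  have c2 : ((2 : ℤ_[2]) : ℚ_[2]) = 2 := map_ofNat PadicInt.Coe.ringHom 2
  have c4 : ((4 : ℤ_[2]) : ℚ_[2]) = 4 := map_ofNat PadicInt.Coe.ringHom 4
  ext <;> simp [WeierstrassCurve.quadraticTwist, WeierstrassCurve.map, WeierstrassCurve.b₂, WeierstrassCurve.b₄,
    WeierstrassCurve.b₆, c2, c4] <;> ring

/-! ## §3 The exit models `T″ = (1, 0, α, 2γ) • T` and `T‴ = (1, 2, 0, 0) • T″` -/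

section Exit

variable (α p γ q r : ℤ_[2])

/-- `T″ = (1, 0, α, 2γ) • [0, −(α²+2p), 0, 4(q+αγ), −4(γ²+2r)] = [2α, −2(α²+p), 4γ, 4q, −8(γ²+r)]`: coefficient `a₁″`. [folklore] -/
private theorem tI_a₁ : ((⟨1, 0, α, 2 * γ⟩ : VariableChange ℤ_[2]) •
    (⟨0, -(α ^ 2 + 2 * p), 0, 4 * (q + α * γ), -(4 * (γ ^ 2 + 2 * r))⟩ : WeierstrassCurve ℤ_[2])).a₁ = 2 * α := by
  rw [variableChange_a₁]; simp
/-- coefficient `a₂″ = 2·(−(α² + p))`. [folklore] -/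
private theorem tI_a₂ : ((⟨1, 0, α, 2 * γ⟩ : VariableChange ℤ_[2]) •
    (⟨0, -(α ^ 2 + 2 * p), 0, 4 * (q + α * γ), -(4 * (γ ^ 2 + 2 * r))⟩ : WeierstrassCurve ℤ_[2])).a₂ = 2 * (-(α ^ 2 + p)) := by
  rw [variableChange_a₂]; simp; ring
/-- coefficient `a₃″ = 4γ`. [folklore] -/
private theorem tI_a₃ : ((⟨1, 0, α, 2 * γ⟩ : VariableChange ℤ_[2]) •
    (⟨0, -(α ^ 2 + 2 * p), 0, 4 * (q + α * γ), -(4 * (γ ^ 2 + 2 * r))⟩ : WeierstrassCurve ℤ_[2])).a₃ = 2 ^ 2 * γ := by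
  rw [variableChange_a₃]; simp; ring
/-- coefficient `a₄″ = 4q`. [folklore] -/
private theorem tI_a₄ : ((⟨1, 0, α, 2 * γ⟩ : VariableChange ℤ_[2]) •
    (⟨0, -(α ^ 2 + 2 * p), 0, 4 * (q + α * γ), -(4 * (γ ^ 2 + 2 * r))⟩ : WeierstrassCurve ℤ_[2])).a₄ = 2 ^ 2 * q := by
  rw [variableChange_a₄]; simp; ring
/-- coefficient `a₆″ = 8·(−(γ² + r))`. [folklore] -/
private theorem tI_a₆ : ((⟨1, 0, α, 2 * γ⟩ : VariableChange ℤ_[2]) •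
    (⟨0, -(α ^ 2 + 2 * p), 0, 4 * (q + α * γ), -(4 * (γ ^ 2 + 2 * r))⟩ : WeierstrassCurve ℤ_[2])).a₆ = 2 ^ 3 * (-(γ ^ 2 + r)) := by
  rw [variableChange_a₆]; simp; ring

/-- `T‴ = (1, 2, 0, 0) • T″ = [2α, 2(3 − (α²+p)), 4(γ+α), 4(q + 3 − 2(α²+p)), 8(1 + q − (α²+p) − (γ²+r))]`: coefficient `a₁‴`. [folklore] -/
private theorem tJ_a₁ : ((⟨1, 2, 0, 0⟩ : VariableChange ℤ_[2]) • ((⟨1, 0, α, 2 * γ⟩ : VariableChange ℤ_[2]) •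
    (⟨0, -(α ^ 2 + 2 * p), 0, 4 * (q + α * γ), -(4 * (γ ^ 2 + 2 * r))⟩ : WeierstrassCurve ℤ_[2]))).a₁ = 2 * α := by
  rw [variableChange_a₁, tI_a₁]; simp
/-- coefficient `a₂‴`. [folklore] -/
private theorem tJ_a₂ : ((⟨1, 2, 0, 0⟩ : VariableChange ℤ_[2]) • ((⟨1, 0, α, 2 * γ⟩ : VariableChange ℤ_[2]) •
    (⟨0, -(α ^ 2 + 2 * p), 0, 4 * (q + α * γ), -(4 * (γ ^ 2 + 2 * r))⟩ : WeierstrassCurve ℤ_[2]))).a₂ =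
      2 * (3 - (α ^ 2 + p)) := by
  rw [variableChange_a₂, tI_a₁, tI_a₂]; simp; ring
/-- coefficient `a₃‴`. [folklore] -/
private theorem tJ_a₃ : ((⟨1, 2, 0, 0⟩ : VariableChange ℤ_[2]) • ((⟨1, 0, α, 2 * γ⟩ : VariableChange ℤ_[2]) •
    (⟨0, -(α ^ 2 + 2 * p), 0, 4 * (q + α * γ), -(4 * (γ ^ 2 + 2 * r))⟩ : WeierstrassCurve ℤ_[2]))).a₃ =
      2 ^ 2 * (γ + α) := by
  rw [variableChange_a₃, tI_a₁, tI_a₃]; simp; ring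
/-- coefficient `a₄‴`. [folklore] -/
private theorem tJ_a₄ : ((⟨1, 2, 0, 0⟩ : VariableChange ℤ_[2]) • ((⟨1, 0, α, 2 * γ⟩ : VariableChange ℤ_[2]) •
    (⟨0, -(α ^ 2 + 2 * p), 0, 4 * (q + α * γ), -(4 * (γ ^ 2 + 2 * r))⟩ : WeierstrassCurve ℤ_[2]))).a₄ =
      2 ^ 2 * (q + 3 - 2 * (α ^ 2 + p)) := by
  rw [variableChange_a₄, tI_a₁, tI_a₂, tI_a₃, tI_a₄]; simp; ring
/-- coefficient `a₆‴`. [folklore] -/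
private theorem tJ_a₆ : ((⟨1, 2, 0, 0⟩ : VariableChange ℤ_[2]) • ((⟨1, 0, α, 2 * γ⟩ : VariableChange ℤ_[2]) •
    (⟨0, -(α ^ 2 + 2 * p), 0, 4 * (q + α * γ), -(4 * (γ ^ 2 + 2 * r))⟩ : WeierstrassCurve ℤ_[2]))).a₆ =
      2 ^ 3 * (1 + q - (α ^ 2 + p) - (γ ^ 2 + r)) := by
  rw [variableChange_a₆, tI_a₁, tI_a₂, tI_a₃, tI_a₄, tI_a₆]; simp; ring

end Exit


section Exits

variable {α p γ q r : ℤ_[2]}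

/-- `b₂″ = 2·(2α² − 4(α²+p))`, `b₆″ = 8·(2γ² − 4(γ²+r))`, `b₈″ = 8·(…)`: the Step 2–5 tests fail on `T″` and it is Step-6 normalised
(all in terms of the uniformiser). [cite: SilvermanATAEC1994, IV.9.4 Steps 1–6] -/
private theorem tI_step6 :
    uniformizer ℤ_[2] ∣ ((⟨1, 0, α, 2 * γ⟩ : VariableChange ℤ_[2]) •
    (⟨0, -(α ^ 2 + 2 * p), 0, 4 * (q + α * γ), -(4 * (γ ^ 2 + 2 * r))⟩ : WeierstrassCurve ℤ_[2])).Δ ∧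
    uniformizer ℤ_[2] ∣ ((⟨1, 0, α, 2 * γ⟩ : VariableChange ℤ_[2]) •
    (⟨0, -(α ^ 2 + 2 * p), 0, 4 * (q + α * γ), -(4 * (γ ^ 2 + 2 * r))⟩ : WeierstrassCurve ℤ_[2])).a₃ ∧ uniformizer ℤ_[2] ∣ ((⟨1, 0, α, 2 * γ⟩ : VariableChange ℤ_[2]) •
    (⟨0, -(α ^ 2 + 2 * p), 0, 4 * (q + α * γ), -(4 * (γ ^ 2 + 2 * r))⟩ : WeierstrassCurve ℤ_[2])).a₄ ∧ uniformizer ℤ_[2] ∣ ((⟨1, 0, α, 2 * γ⟩ : VariableChange ℤ_[2]) •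
    (⟨0, -(α ^ 2 + 2 * p), 0, 4 * (q + α * γ), -(4 * (γ ^ 2 + 2 * r))⟩ : WeierstrassCurve ℤ_[2])).a₆ ∧
    uniformizer ℤ_[2] ∣ ((⟨1, 0, α, 2 * γ⟩ : VariableChange ℤ_[2]) •
    (⟨0, -(α ^ 2 + 2 * p), 0, 4 * (q + α * γ), -(4 * (γ ^ 2 + 2 * r))⟩ : WeierstrassCurve ℤ_[2])).b₂ ∧ uniformizer ℤ_[2] ^ 2 ∣ ((⟨1, 0, α, 2 * γ⟩ : VariableChange ℤ_[2]) •
    (⟨0, -(α ^ 2 + 2 * p), 0, 4 * (q + α * γ), -(4 * (γ ^ 2 + 2 * r))⟩ : WeierstrassCurve ℤ_[2])).a₆ ∧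
    uniformizer ℤ_[2] ^ 3 ∣ ((⟨1, 0, α, 2 * γ⟩ : VariableChange ℤ_[2]) •
    (⟨0, -(α ^ 2 + 2 * p), 0, 4 * (q + α * γ), -(4 * (γ ^ 2 + 2 * r))⟩ : WeierstrassCurve ℤ_[2])).b₈ ∧ uniformizer ℤ_[2] ^ 3 ∣ ((⟨1, 0, α, 2 * γ⟩ : VariableChange ℤ_[2]) •
    (⟨0, -(α ^ 2 + 2 * p), 0, 4 * (q + α * γ), -(4 * (γ ^ 2 + 2 * r))⟩ : WeierstrassCurve ℤ_[2])).b₆ ∧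
    uniformizer ℤ_[2] ∣ ((⟨1, 0, α, 2 * γ⟩ : VariableChange ℤ_[2]) •
    (⟨0, -(α ^ 2 + 2 * p), 0, 4 * (q + α * γ), -(4 * (γ ^ 2 + 2 * r))⟩ : WeierstrassCurve ℤ_[2])).a₁ ∧ uniformizer ℤ_[2] ∣ ((⟨1, 0, α, 2 * γ⟩ : VariableChange ℤ_[2]) •
    (⟨0, -(α ^ 2 + 2 * p), 0, 4 * (q + α * γ), -(4 * (γ ^ 2 + 2 * r))⟩ : WeierstrassCurve ℤ_[2])).a₂ ∧
    uniformizer ℤ_[2] ^ 2 ∣ ((⟨1, 0, α, 2 * γ⟩ : VariableChange ℤ_[2]) •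
    (⟨0, -(α ^ 2 + 2 * p), 0, 4 * (q + α * γ), -(4 * (γ ^ 2 + 2 * r))⟩ : WeierstrassCurve ℤ_[2])).a₃ ∧ uniformizer ℤ_[2] ^ 2 ∣ ((⟨1, 0, α, 2 * γ⟩ : VariableChange ℤ_[2]) •
    (⟨0, -(α ^ 2 + 2 * p), 0, 4 * (q + α * γ), -(4 * (γ ^ 2 + 2 * r))⟩ : WeierstrassCurve ℤ_[2])).a₄ ∧ uniformizer ℤ_[2] ^ 3 ∣ ((⟨1, 0, α, 2 * γ⟩ : VariableChange ℤ_[2]) •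
    (⟨0, -(α ^ 2 + 2 * p), 0, 4 * (q + α * γ), -(4 * (γ ^ 2 + 2 * r))⟩ : WeierstrassCurve ℤ_[2])).a₆ := by
  simp only [uniformizer_dvd_iff_two_dvd, uniformizer_pow_dvd_iff_two_pow_dvd]
  have hb₂ : ((⟨1, 0, α, 2 * γ⟩ : VariableChange ℤ_[2]) •
    (⟨0, -(α ^ 2 + 2 * p), 0, 4 * (q + α * γ), -(4 * (γ ^ 2 + 2 * r))⟩ : WeierstrassCurve ℤ_[2])).b₂ = 2 * (2 * α ^ 2 + 4 * (-(α ^ 2 + p))) := by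
    rw [WeierstrassCurve.b₂, tI_a₁, tI_a₂]; ring
  have hb₄ : ((⟨1, 0, α, 2 * γ⟩ : VariableChange ℤ_[2]) •
    (⟨0, -(α ^ 2 + 2 * p), 0, 4 * (q + α * γ), -(4 * (γ ^ 2 + 2 * r))⟩ : WeierstrassCurve ℤ_[2])).b₄ = 2 * (4 * q + 4 * α * γ) := by
    rw [WeierstrassCurve.b₄, tI_a₁, tI_a₃, tI_a₄]; ring
  have hb₆ : ((⟨1, 0, α, 2 * γ⟩ : VariableChange ℤ_[2]) •
    (⟨0, -(α ^ 2 + 2 * p), 0, 4 * (q + α * γ), -(4 * (γ ^ 2 + 2 * r))⟩ : WeierstrassCurve ℤ_[2])).b₆ = 2 ^ 3 * (2 * γ ^ 2 + 4 * (-(γ ^ 2 + r))) := by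
    rw [WeierstrassCurve.b₆, tI_a₃, tI_a₆]; ring
  have hb₈ : ((⟨1, 0, α, 2 * γ⟩ : VariableChange ℤ_[2]) •
    (⟨0, -(α ^ 2 + 2 * p), 0, 4 * (q + α * γ), -(4 * (γ ^ 2 + 2 * r))⟩ : WeierstrassCurve ℤ_[2])).b₈ = 2 ^ 3 * (4 * α ^ 2 * (-(γ ^ 2 + r)) + 8 * (-(α ^ 2 + p)) * (-(γ ^ 2 + r))
      - 4 * α * γ * q + 4 * (-(α ^ 2 + p)) * γ ^ 2 - 2 * q ^ 2) := by
    rw [WeierstrassCurve.b₈, tI_a₁, tI_a₂, tI_a₃, tI_a₄, tI_a₆]; ring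
  have d2 : (2 : ℤ_[2]) ∣ 2 ^ 2 := dvd_pow_self 2 two_ne_zero
  have d3 : (2 : ℤ_[2]) ∣ 2 ^ 3 := dvd_pow_self 2 three_ne_zero
  refine ⟨?_, ?_, ?_, ?_, ?_, ?_, ?_, ?_, ?_, ?_, ?_, ?_, ?_⟩
  · exact dvd_Δ_of_dvd_b (by rw [hb₂]; exact dvd_mul_right _ _) (by rw [hb₄]; exact dvd_mul_right _ _)
      (by rw [hb₆]; exact d3.trans (dvd_mul_right _ _)) (by rw [hb₈]; exact d3.trans (dvd_mul_right _ _))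
  · rw [tI_a₃]; exact d2.trans (dvd_mul_right _ _)
  · rw [tI_a₄]; exact d2.trans (dvd_mul_right _ _)
  · rw [tI_a₆]; exact d3.trans (dvd_mul_right _ _)
  · rw [hb₂]; exact dvd_mul_right _ _
  · rw [tI_a₆]; exact (pow_dvd_pow 2 (by norm_num)).trans (dvd_mul_right _ _)
  · rw [hb₈]; exact dvd_mul_right _ _
  · rw [hb₆]; exact dvd_mul_right _ _
  · rw [tI_a₁]; exact dvd_mul_right _ _
  · rw [tI_a₂]; exact dvd_mul_right _ _
  · rw [tI_a₃]; exact dvd_mul_right _ _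
  · rw [tI_a₄]; exact dvd_mul_right _ _
  · rw [tI_a₆]; exact dvd_mul_right _ _

/-- The Step-6 cubic of `T″` is `T³ + P̄′T² + q̄T + R̄′` with `P′ = −(α²+p)`, `R′ = −(γ²+r)`. [folklore] -/
private theorem tI_cubicStep6 :
    cubicStep6 ((⟨1, 0, α, 2 * γ⟩ : VariableChange ℤ_[2]) •
    (⟨0, -(α ^ 2 + 2 * p), 0, 4 * (q + α * γ), -(4 * (γ ^ 2 + 2 * r))⟩ : WeierstrassCurve ℤ_[2])) = X ^ 3 + C (residue ℤ_[2] (-(α ^ 2 + p))) * X ^ 2 + C (residue ℤ_[2] q) * X +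
      C (residue ℤ_[2] (-(γ ^ 2 + r))) := by
  rw [cubicStep6, tI_a₂, tI_a₄, tI_a₆, redCoeff_two_mul, redCoeff_two_pow_mul, redCoeff_two_pow_mul]

/-- `2 = 0`, `4 = 0`, `3 = 1`, `27 = 1`, `18 = 0` in the residue field of `ℤ₂`. [folklore] -/
private theorem resid_consts : (2 : ResidueField ℤ_[2]) = 0 ∧ (4 : ResidueField ℤ_[2]) = 0 ∧
    (3 : ResidueField ℤ_[2]) = 1 ∧ (27 : ResidueField ℤ_[2]) = 1 ∧ (18 : ResidueField ℤ_[2]) = 0 := by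
  have h2 := two_eq_zero_residueField_padicInt
  refine ⟨h2, ?_, ?_, ?_, ?_⟩
  · rw [show (4 : ResidueField ℤ_[2]) = 2 * 2 by norm_num, h2, mul_zero]
  · rw [show (3 : ResidueField ℤ_[2]) = 2 + 1 by norm_num, h2, zero_add]
  · rw [show (27 : ResidueField ℤ_[2]) = 2 * 13 + 1 by norm_num, h2, zero_mul, zero_add]
  · rw [show (18 : ResidueField ℤ_[2]) = 2 * 9 by norm_num, h2, zero_mul]

/-- **Case A0 — type IV*.**  `2 ∣ α² + p`, `2 ∣ q`, `2 ∣ γ² + r`, `γ ∈ ℤ₂ˣ`: `T″` is Step-8 normalised with quadratic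
`Y² + γ̄Y − …`, separable. [cite: SilvermanATAEC1994, IV.9.4 Steps 6–8] -/
theorem kodairaSymbolOfMinimal_negTwist_IstarZero_IVstar (hP : (2 : ℤ_[2]) ∣ α ^ 2 + p) (hq : (2 : ℤ_[2]) ∣ q)
    (hR : (2 : ℤ_[2]) ∣ γ ^ 2 + r) (hγ : IsUnit γ) :
    ((⟨1, 0, α, 2 * γ⟩ : VariableChange ℤ_[2]) •
    (⟨0, -(α ^ 2 + 2 * p), 0, 4 * (q + α * γ), -(4 * (γ ^ 2 + 2 * r))⟩ : WeierstrassCurve ℤ_[2])).kodairaSymbolOfMinimal = .IVstar := by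
  obtain ⟨P₂, hP₂⟩ := hP
  obtain ⟨q₂, hq₂⟩ := hq
  obtain ⟨R₂, hR₂⟩ := hR
  have e2 : ((⟨1, 0, α, 2 * γ⟩ : VariableChange ℤ_[2]) •
    (⟨0, -(α ^ 2 + 2 * p), 0, 4 * (q + α * γ), -(4 * (γ ^ 2 + 2 * r))⟩ : WeierstrassCurve ℤ_[2])).a₂ = 2 ^ 2 * (-P₂) := by rw [tI_a₂, hP₂]; ring
  have e4 : ((⟨1, 0, α, 2 * γ⟩ : VariableChange ℤ_[2]) •
    (⟨0, -(α ^ 2 + 2 * p), 0, 4 * (q + α * γ), -(4 * (γ ^ 2 + 2 * r))⟩ : WeierstrassCurve ℤ_[2])).a₄ = 2 ^ 3 * q₂ := by rw [tI_a₄, hq₂]; ring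
  have e6 : ((⟨1, 0, α, 2 * γ⟩ : VariableChange ℤ_[2]) •
    (⟨0, -(α ^ 2 + 2 * p), 0, 4 * (q + α * γ), -(4 * (γ ^ 2 + 2 * r))⟩ : WeierstrassCurve ℤ_[2])).a₆ = 2 ^ 4 * (-R₂) := by rw [tI_a₆, hR₂]; ring
  refine kodairaSymbolOfMinimal_eq_IVstar_of_step8 ?_ ?_ ?_ ?_ ?_ ?_ <;>
    try simp only [uniformizer_dvd_iff_two_dvd, uniformizer_pow_dvd_iff_two_pow_dvd]
  · rw [tI_a₁]; exact dvd_mul_right _ _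
  · rw [e2]; exact dvd_mul_right _ _
  · rw [tI_a₃]; exact dvd_mul_right _ _
  · rw [e4]; exact dvd_mul_right _ _
  · rw [e6]; exact dvd_mul_right _ _
  · rw [quadraticStep8, tI_a₃, e6, redCoeff_two_pow_mul, redCoeff_two_pow_mul, distinctRootCount_sq_add_sub_eq_two_iff,
      resid_consts.2.1, zero_mul, add_zero]
    exact pow_ne_zero 2 ((residue_ne_zero_iff_isUnit _).mpr hγ)

/-- **Case A1 — type IV* after the translation `x ↦ x + 2`.**  On `T‴ = (1, 2, 0, 0) • T″`: `4 ∣ a₂‴`, `8 ∣ a₄‴`, `16 ∣ a₆‴` and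
`a₃‴ = 4(γ + α)` with `γ + α ∈ ℤ₂ˣ`. [cite: SilvermanATAEC1994, IV.9.4 Steps 6–8] -/
theorem kodairaSymbolOfMinimal_negTwist_IstarZero_IVstar' (h2 : (2 : ℤ_[2]) ∣ 3 - (α ^ 2 + p))
    (h4 : (2 : ℤ_[2]) ∣ q + 3 - 2 * (α ^ 2 + p)) (h6 : (2 : ℤ_[2]) ∣ 1 + q - (α ^ 2 + p) - (γ ^ 2 + r))
    (hu : IsUnit (γ + α)) :
    ((⟨1, 2, 0, 0⟩ : VariableChange ℤ_[2]) • ((⟨1, 0, α, 2 * γ⟩ : VariableChange ℤ_[2]) •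
    (⟨0, -(α ^ 2 + 2 * p), 0, 4 * (q + α * γ), -(4 * (γ ^ 2 + 2 * r))⟩ : WeierstrassCurve ℤ_[2]))).kodairaSymbolOfMinimal = .IVstar := by
  obtain ⟨P₂, hP₂⟩ := h2
  obtain ⟨q₂, hq₂⟩ := h4
  obtain ⟨R₂, hR₂⟩ := h6
  have e2 : ((⟨1, 2, 0, 0⟩ : VariableChange ℤ_[2]) • ((⟨1, 0, α, 2 * γ⟩ : VariableChange ℤ_[2]) •
    (⟨0, -(α ^ 2 + 2 * p), 0, 4 * (q + α * γ), -(4 * (γ ^ 2 + 2 * r))⟩ : WeierstrassCurve ℤ_[2]))).a₂ = 2 ^ 2 * P₂ := by rw [tJ_a₂, hP₂]; ring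
  have e4 : ((⟨1, 2, 0, 0⟩ : VariableChange ℤ_[2]) • ((⟨1, 0, α, 2 * γ⟩ : VariableChange ℤ_[2]) •
    (⟨0, -(α ^ 2 + 2 * p), 0, 4 * (q + α * γ), -(4 * (γ ^ 2 + 2 * r))⟩ : WeierstrassCurve ℤ_[2]))).a₄ = 2 ^ 3 * q₂ := by rw [tJ_a₄, hq₂]; ring
  have e6 : ((⟨1, 2, 0, 0⟩ : VariableChange ℤ_[2]) • ((⟨1, 0, α, 2 * γ⟩ : VariableChange ℤ_[2]) •
    (⟨0, -(α ^ 2 + 2 * p), 0, 4 * (q + α * γ), -(4 * (γ ^ 2 + 2 * r))⟩ : WeierstrassCurve ℤ_[2]))).a₆ = 2 ^ 4 * R₂ := by rw [tJ_a₆, hR₂]; ring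
  refine kodairaSymbolOfMinimal_eq_IVstar_of_step8 ?_ ?_ ?_ ?_ ?_ ?_ <;>
    try simp only [uniformizer_dvd_iff_two_dvd, uniformizer_pow_dvd_iff_two_pow_dvd]
  · rw [tJ_a₁]; exact dvd_mul_right _ _
  · rw [e2]; exact dvd_mul_right _ _
  · rw [tJ_a₃]; exact dvd_mul_right _ _
  · rw [e4]; exact dvd_mul_right _ _
  · rw [e6]; exact dvd_mul_right _ _
  · rw [quadraticStep8, tJ_a₃, e6, redCoeff_two_pow_mul, redCoeff_two_pow_mul, distinctRootCount_sq_add_sub_eq_two_iff,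
      resid_consts.2.1, zero_mul, add_zero]
    exact pow_ne_zero 2 ((residue_ne_zero_iff_isUnit _).mpr hu)

/-- **Case B0 — type I₁*.**  `2 ∤ α² + p`, `2 ∣ q`, `2 ∣ γ² + r`, `γ ∈ ℤ₂ˣ`: `T″` is normalised for round `0` of Step 7 (cubic
`T²(T + 1)`), and the first quadratic `Y² + γ̄Y − …` is separable, so `n = 1` (fuel `ord Δ(T″) = 8`).
[cite: SilvermanATAEC1994, IV.9.4 Steps 6–7] -/
theorem kodairaSymbolOfMinimal_negTwist_IstarZero_IstarOne (hP : ¬ (2 : ℤ_[2]) ∣ α ^ 2 + p) (hq : (2 : ℤ_[2]) ∣ q)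
    (hR : (2 : ℤ_[2]) ∣ γ ^ 2 + r) (hγ : IsUnit γ) (hΔ8 : (addVal ℤ_[2] ((⟨1, 0, α, 2 * γ⟩ : VariableChange ℤ_[2]) •
    (⟨0, -(α ^ 2 + 2 * p), 0, 4 * (q + α * γ), -(4 * (γ ^ 2 + 2 * r))⟩ : WeierstrassCurve ℤ_[2])).Δ).toNat = 8) :
    ((⟨1, 0, α, 2 * γ⟩ : VariableChange ℤ_[2]) •
    (⟨0, -(α ^ 2 + 2 * p), 0, 4 * (q + α * γ), -(4 * (γ ^ 2 + 2 * r))⟩ : WeierstrassCurve ℤ_[2])).kodairaSymbolOfMinimal = .Istar 1 := by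
  obtain ⟨hΔ, n3, n4, n6, hb₂, ha₆, hb₈, hb₆, q1, q2, q3, q4, q6⟩ := tI_step6 (α := α) (p := p) (γ := γ) (q := q) (r := r)
  obtain ⟨q₂, hq₂⟩ := hq
  obtain ⟨R₂, hR₂⟩ := hR
  have hP' : ¬ (2 : ℤ_[2]) ∣ -(α ^ 2 + p) := fun h ↦ hP (dvd_neg.mp h)
  have e4 : ((⟨1, 0, α, 2 * γ⟩ : VariableChange ℤ_[2]) •
    (⟨0, -(α ^ 2 + 2 * p), 0, 4 * (q + α * γ), -(4 * (γ ^ 2 + 2 * r))⟩ : WeierstrassCurve ℤ_[2])).a₄ = 2 ^ 3 * q₂ := by rw [tI_a₄, hq₂]; ring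
  have e6 : ((⟨1, 0, α, 2 * γ⟩ : VariableChange ℤ_[2]) •
    (⟨0, -(α ^ 2 + 2 * p), 0, 4 * (q + α * γ), -(4 * (γ ^ 2 + 2 * r))⟩ : WeierstrassCurve ℤ_[2])).a₆ = 2 ^ 4 * (-R₂) := by rw [tI_a₆, hR₂]; ring
  -- the cubic `T²(T + 1)`: exactly two roots
  have hres_q : residue ℤ_[2] q = 0 := (two_dvd_iff_residue_eq_zero q).mp ⟨q₂, hq₂⟩
  have hres_R : residue ℤ_[2] (-(γ ^ 2 + r)) = 0 := (two_dvd_iff_residue_eq_zero _).mp (dvd_neg.mpr ⟨R₂, hR₂⟩)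
  have hres_P : residue ℤ_[2] (-(α ^ 2 + p)) = 1 := by
    rcases residueField_two_eq_zero_or_one (residue ℤ_[2] (-(α ^ 2 + p))) with h | h
    · exact absurd ((two_dvd_iff_residue_eq_zero _).mpr h) hP'
    · exact h
  have h7 : distinctRootCount (cubicStep6 ((⟨1, 0, α, 2 * γ⟩ : VariableChange ℤ_[2]) •
    (⟨0, -(α ^ 2 + 2 * p), 0, 4 * (q + α * γ), -(4 * (γ ^ 2 + 2 * r))⟩ : WeierstrassCurve ℤ_[2]))) = 2 := by
    rw [tI_cubicStep6, hres_q, hres_R, hres_P]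
    obtain ⟨c2, c4, c3, c27, c18⟩ := resid_consts
    rw [distinctRootCount_cubic_eq_two_iff _ _ _ (by rw [c4, c27, c18]; ring)]
    rw [c3]; norm_num
  have s2n : ¬ uniformizer ℤ_[2] ^ 2 ∣ ((⟨1, 0, α, 2 * γ⟩ : VariableChange ℤ_[2]) •
    (⟨0, -(α ^ 2 + 2 * p), 0, 4 * (q + α * γ), -(4 * (γ ^ 2 + 2 * r))⟩ : WeierstrassCurve ℤ_[2])).a₂ := by
    rw [uniformizer_pow_dvd_iff_two_pow_dvd, tI_a₂, show (2 : ℤ_[2]) ^ 2 = 2 ^ 1 * 2 by norm_num, pow_one]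
    exact fun h ↦ hP' ((mul_dvd_mul_iff_left (by norm_num)).mp h)
  have s4 : uniformizer ℤ_[2] ^ 3 ∣ ((⟨1, 0, α, 2 * γ⟩ : VariableChange ℤ_[2]) •
    (⟨0, -(α ^ 2 + 2 * p), 0, 4 * (q + α * γ), -(4 * (γ ^ 2 + 2 * r))⟩ : WeierstrassCurve ℤ_[2])).a₄ := by rw [uniformizer_pow_dvd_iff_two_pow_dvd, e4]; exact dvd_mul_right _ _
  have s6 : uniformizer ℤ_[2] ^ 4 ∣ ((⟨1, 0, α, 2 * γ⟩ : VariableChange ℤ_[2]) •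
    (⟨0, -(α ^ 2 + 2 * p), 0, 4 * (q + α * γ), -(4 * (γ ^ 2 + 2 * r))⟩ : WeierstrassCurve ℤ_[2])).a₆ := by rw [uniformizer_pow_dvd_iff_two_pow_dvd, e6]; exact dvd_mul_right _ _
  rw [kodairaSymbolOfMinimal_eq_Istar_of_models (C₂ := 1) (C₆ := 1) (C₇ := 1) hΔ (one_smul _ _).symm n3 n4 n6 hb₂ ha₆ hb₈ hb₆
    (one_smul _ _).symm q1 q2 q3 q4 q6 h7 (one_smul _ _).symm q1 q2 s2n q3 s4 s6, hΔ8,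
    show (8 : ℕ) = 7 + 1 from rfl, istarIndexAux_succ_of_testA]
  rw [tI_a₃, e6, redCoeff_two_pow_mul, redCoeff_two_pow_mul, distinctRootCount_sq_add_sub_eq_two_iff, resid_consts.2.1,
    zero_mul, add_zero]
  exact pow_ne_zero 2 ((residue_ne_zero_iff_isUnit _).mpr hγ)

/-- **Case B1 — type I₁* after the translation `x ↦ x + 2`.**  `2 ∣ α² + p`, `2 ∤ q`, `2 ∣ γ² + r`, `γ + α ∈ ℤ₂ˣ`: the cubic of `T″`
is `T(T + 1)²`, the round-`0` model is `T‴`, and its first quadratic `Y² + (γ+α)‾Y − …` is separable: `n = 1`.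
[cite: SilvermanATAEC1994, IV.9.4 Steps 6–7] -/
theorem kodairaSymbolOfMinimal_negTwist_IstarZero_IstarOne' (hP : (2 : ℤ_[2]) ∣ α ^ 2 + p) (hq : ¬ (2 : ℤ_[2]) ∣ q)
    (hR : (2 : ℤ_[2]) ∣ γ ^ 2 + r) (h4 : (2 : ℤ_[2]) ∣ q + 3 - 2 * (α ^ 2 + p))
    (h6 : (2 : ℤ_[2]) ∣ 1 + q - (α ^ 2 + p) - (γ ^ 2 + r)) (hu : IsUnit (γ + α))
    (hΔ8 : (addVal ℤ_[2] ((⟨1, 0, α, 2 * γ⟩ : VariableChange ℤ_[2]) •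
    (⟨0, -(α ^ 2 + 2 * p), 0, 4 * (q + α * γ), -(4 * (γ ^ 2 + 2 * r))⟩ : WeierstrassCurve ℤ_[2])).Δ).toNat = 8) :
    ((⟨1, 0, α, 2 * γ⟩ : VariableChange ℤ_[2]) •
    (⟨0, -(α ^ 2 + 2 * p), 0, 4 * (q + α * γ), -(4 * (γ ^ 2 + 2 * r))⟩ : WeierstrassCurve ℤ_[2])).kodairaSymbolOfMinimal = .Istar 1 := by
  obtain ⟨hΔ, n3, n4, n6, hb₂, ha₆, hb₈, hb₆, q1, q2, q3, q4, q6⟩ := tI_step6 (α := α) (p := p) (γ := γ) (q := q) (r := r)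
  obtain ⟨q₂, hq₂⟩ := h4
  obtain ⟨R₂, hR₂⟩ := h6
  have e4 : ((⟨1, 2, 0, 0⟩ : VariableChange ℤ_[2]) • ((⟨1, 0, α, 2 * γ⟩ : VariableChange ℤ_[2]) •
    (⟨0, -(α ^ 2 + 2 * p), 0, 4 * (q + α * γ), -(4 * (γ ^ 2 + 2 * r))⟩ : WeierstrassCurve ℤ_[2]))).a₄ = 2 ^ 3 * q₂ := by rw [tJ_a₄, hq₂]; ring
  have e6 : ((⟨1, 2, 0, 0⟩ : VariableChange ℤ_[2]) • ((⟨1, 0, α, 2 * γ⟩ : VariableChange ℤ_[2]) •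
    (⟨0, -(α ^ 2 + 2 * p), 0, 4 * (q + α * γ), -(4 * (γ ^ 2 + 2 * r))⟩ : WeierstrassCurve ℤ_[2]))).a₆ = 2 ^ 4 * R₂ := by rw [tJ_a₆, hR₂]; ring
  -- the cubic `T(T + 1)²`: exactly two roots
  have hres_q : residue ℤ_[2] q = 1 := by
    rcases residueField_two_eq_zero_or_one (residue ℤ_[2] q) with h | h
    · exact absurd ((two_dvd_iff_residue_eq_zero _).mpr h) hq
    · exact h
  have hres_R : residue ℤ_[2] (-(γ ^ 2 + r)) = 0 := (two_dvd_iff_residue_eq_zero _).mp (dvd_neg.mpr hR)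
  have hres_P : residue ℤ_[2] (-(α ^ 2 + p)) = 0 := (two_dvd_iff_residue_eq_zero _).mp (dvd_neg.mpr hP)
  have h7 : distinctRootCount (cubicStep6 ((⟨1, 0, α, 2 * γ⟩ : VariableChange ℤ_[2]) •
    (⟨0, -(α ^ 2 + 2 * p), 0, 4 * (q + α * γ), -(4 * (γ ^ 2 + 2 * r))⟩ : WeierstrassCurve ℤ_[2]))) = 2 := by
    rw [tI_cubicStep6, hres_q, hres_R, hres_P]
    obtain ⟨c2, c4, c3, c27, c18⟩ := resid_consts
    rw [distinctRootCount_cubic_eq_two_iff _ _ _ (by rw [c4, c27, c18]; ring)]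
    rw [c3]; norm_num
  have hP3 : ¬ (2 : ℤ_[2]) ∣ 3 - (α ^ 2 + p) := by
    intro h
    have : (2 : ℤ_[2]) ∣ 3 := by simpa using dvd_add h hP
    have h1 : (2 : ℤ_[2]) ∣ 1 := by
      have := dvd_sub this (dvd_refl (2 : ℤ_[2]))
      norm_num at this
      exact this
    exact (by exact_mod_cast PadicInt.irreducible_p (p := 2) : Irreducible (2 : ℤ_[2])).not_isUnit (isUnit_of_dvd_one h1)
  have s1 : uniformizer ℤ_[2] ∣ ((⟨1, 2, 0, 0⟩ : VariableChange ℤ_[2]) • ((⟨1, 0, α, 2 * γ⟩ : VariableChange ℤ_[2]) •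
    (⟨0, -(α ^ 2 + 2 * p), 0, 4 * (q + α * γ), -(4 * (γ ^ 2 + 2 * r))⟩ : WeierstrassCurve ℤ_[2]))).a₁ := by rw [uniformizer_dvd_iff_two_dvd, tJ_a₁]; exact dvd_mul_right _ _
  have s2 : uniformizer ℤ_[2] ∣ ((⟨1, 2, 0, 0⟩ : VariableChange ℤ_[2]) • ((⟨1, 0, α, 2 * γ⟩ : VariableChange ℤ_[2]) •
    (⟨0, -(α ^ 2 + 2 * p), 0, 4 * (q + α * γ), -(4 * (γ ^ 2 + 2 * r))⟩ : WeierstrassCurve ℤ_[2]))).a₂ := by rw [uniformizer_dvd_iff_two_dvd, tJ_a₂]; exact dvd_mul_right _ _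
  have s2n : ¬ uniformizer ℤ_[2] ^ 2 ∣ ((⟨1, 2, 0, 0⟩ : VariableChange ℤ_[2]) • ((⟨1, 0, α, 2 * γ⟩ : VariableChange ℤ_[2]) •
    (⟨0, -(α ^ 2 + 2 * p), 0, 4 * (q + α * γ), -(4 * (γ ^ 2 + 2 * r))⟩ : WeierstrassCurve ℤ_[2]))).a₂ := by
    rw [uniformizer_pow_dvd_iff_two_pow_dvd, tJ_a₂, show (2 : ℤ_[2]) ^ 2 = 2 ^ 1 * 2 by norm_num, pow_one]
    exact fun h ↦ hP3 ((mul_dvd_mul_iff_left (by norm_num)).mp h)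
  have s3 : uniformizer ℤ_[2] ^ 2 ∣ ((⟨1, 2, 0, 0⟩ : VariableChange ℤ_[2]) • ((⟨1, 0, α, 2 * γ⟩ : VariableChange ℤ_[2]) •
    (⟨0, -(α ^ 2 + 2 * p), 0, 4 * (q + α * γ), -(4 * (γ ^ 2 + 2 * r))⟩ : WeierstrassCurve ℤ_[2]))).a₃ := by rw [uniformizer_pow_dvd_iff_two_pow_dvd, tJ_a₃]; exact dvd_mul_right _ _
  have s4 : uniformizer ℤ_[2] ^ 3 ∣ ((⟨1, 2, 0, 0⟩ : VariableChange ℤ_[2]) • ((⟨1, 0, α, 2 * γ⟩ : VariableChange ℤ_[2]) •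
    (⟨0, -(α ^ 2 + 2 * p), 0, 4 * (q + α * γ), -(4 * (γ ^ 2 + 2 * r))⟩ : WeierstrassCurve ℤ_[2]))).a₄ := by rw [uniformizer_pow_dvd_iff_two_pow_dvd, e4]; exact dvd_mul_right _ _
  have s6 : uniformizer ℤ_[2] ^ 4 ∣ ((⟨1, 2, 0, 0⟩ : VariableChange ℤ_[2]) • ((⟨1, 0, α, 2 * γ⟩ : VariableChange ℤ_[2]) •
    (⟨0, -(α ^ 2 + 2 * p), 0, 4 * (q + α * γ), -(4 * (γ ^ 2 + 2 * r))⟩ : WeierstrassCurve ℤ_[2]))).a₆ := by rw [uniformizer_pow_dvd_iff_two_pow_dvd, e6]; exact dvd_mul_right _ _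
  rw [kodairaSymbolOfMinimal_eq_Istar_of_models (C₂ := 1) (C₆ := 1) (C₇ := ⟨1, 2, 0, 0⟩) hΔ (one_smul _ _).symm n3 n4 n6
    hb₂ ha₆ hb₈ hb₆ (one_smul _ _).symm q1 q2 q3 q4 q6 h7 rfl s1 s2 s2n s3 s4 s6, hΔ8,
    show (8 : ℕ) = 7 + 1 from rfl, istarIndexAux_succ_of_testA]
  rw [tJ_a₃, e6, redCoeff_two_pow_mul, redCoeff_two_pow_mul, distinctRootCount_sq_add_sub_eq_two_iff, resid_consts.2.1,
    zero_mul, add_zero]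
  exact pow_ne_zero 2 ((residue_ne_zero_iff_isUnit _).mpr hu)

end Exits


end Summit.BirchSwinnertonDyer.BirchSwinnertonDyer.Theorems.ManinLocalTwoThree

end
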